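import Mathlib.Algebra.BigOperators.Group.Finset.Basic
import Mathlib.Algebra.BigOperators.Fin
import Mathlib.Algebra.Module.Defs
import Mathlib.Data.Fin.SuccPred
import Mathlib.Data.Fin.Tuple.Basic
import HarnessLib

/-!
# Faces of ordered tuples: the combinatorics of the full ordered Čech complex

The full (ordered) Čech complex of a cover `𝔘 = (U_i)_{i ∈ ι}` with coefficients in a presheaf
`𝓕` has cochains indexed by ALL tuples `(i₀, …, i_p)`, i.e. by maps `J : Fin (p + 1) → ι`, and
differential `(δ c)_J = Σ_{j=0}^{p+1} (-1)^j c_{J ∘ σ_j}|_{U_J}` where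
`σ_j = Fin.succAbove j : Fin (p + 1) → Fin (p + 2)` omits the `j`-th entry (R. Bott, L. W. Tu,
*Differential Forms in Algebraic Topology* (1982), §8, (8.2)–(8.4); J.-P. Serre, FAC §18; The
Stacks Project, Tag 01ED). This file isolates the two pieces of pure combinatorics on tuples that
both the Čech–de Rham double complex (`Literature.Geometry.Kaehler`) and the Čech–singular double
complex (`Literature.AlgebraicTopology.SingularHomology`) need, so that neither depends on the
other:

* `CechTuple.sum_sum_neg_one_pow_smul_faces_eq_zero` — **`δ ∘ δ = 0`**: for any function `g` on
  the double faces `Fin (n + 1) → Fin (n + 3)` with values in a module,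
  `Σ_i Σ_j (-1)^{i+j} g (σ_i ∘ σ_j) = 0`. Proof: the fixed-point-free involution
  `(i, j) ↦ (σ_i j, predAbove j i)` of `Fin (n+3) × Fin (n+2)` preserves `σ_i ∘ σ_j` (Mathlib's
  `Fin.succAbove_succAbove_succAbove_predAbove`, the cosimplicial identity) and reverses the sign
  (`CechTuple.neg_one_pow_succAbove_add_predAbove`), so the terms cancel in pairs
  (`Finset.sum_ninvolution`) — the argument of Mathlib's `AlternatingFaceMapComplex.d_squared`,
  made elementwise;
* `CechTuple.cons_comp_succAbove_zero`, `CechTuple.cons_comp_succAbove_succ` — the faces of an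
  extended tuple `(i, i₀, …, i_p)`: the `0`-th face is `(i₀, …, i_p)` and the `(j+1)`-st face is
  `(i, (i₀, …, i_p) ∘ σ_j)`; this is what makes `(h c)_J = Σ_i ρ_i c_{(i, J)}` a contracting
  homotopy of the Čech rows (Bott–Tu (1982), Prop. 8.5).

Everything is proved; no definitions beyond Mathlib's `Fin.succAbove`, `Fin.predAbove`,
`Fin.cons`.

## References

* R. Bott, L. W. Tu, *Differential Forms in Algebraic Topology*, GTM 82, Springer 1982, §8,
  (8.2)–(8.4) and Prop. 8.5. [BottTu1982Forms]
* C. A. Weibel, *An Introduction to Homological Algebra*, CUP 1994, 8.1.9–8.2.1 (cosimplicial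
  identities, the alternating cochain complex). [Weibel1994]
-/

namespace Literature.Algebra.Homology

namespace CechTuple

open Finset

/-! ### The sign of the swapped pair of face indices -/

/-- For `i : Fin (n + 2)`, `j : Fin (n + 1)`, the swapped pair `(σ_i j, predAbove j i)` has total
index of the opposite parity: `(-1)^{σ_i j + predAbove j i} = -(-1)^{i + j}`. [folklore] -/
theorem neg_one_pow_succAbove_add_predAbove {R : Type*} [Monoid R] [HasDistribNeg R] {n : ℕ}
    (i : Fin (n + 2)) (j : Fin (n + 1)) :
    (-1 : R) ^ ((i.succAbove j : ℕ) + (j.predAbove i : ℕ)) = -(-1 : R) ^ ((i : ℕ) + (j : ℕ)) := by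
  have key : ((i.succAbove j : ℕ) + (j.predAbove i : ℕ) + 1 = (i : ℕ) + j) ∨
      ((i.succAbove j : ℕ) + (j.predAbove i : ℕ) = (i : ℕ) + j + 1) := by
    rcases lt_or_ge (Fin.castSucc j) i with h | h
    · left
      have h' : (j : ℕ) < (i : ℕ) := by
        have h'' := Fin.lt_def.1 h
        rwa [Fin.val_castSucc] at h''
      rw [Fin.succAbove_of_castSucc_lt _ _ h, Fin.predAbove_of_castSucc_lt _ _ h, Fin.val_castSucc,
        Fin.val_pred]
      omega
    · right
      rw [Fin.succAbove_of_le_castSucc _ _ h, Fin.predAbove_of_le_castSucc _ _ h, Fin.val_succ,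
        Fin.coe_castPred]
      omega
  rcases key with h | h
  · rw [← h, pow_succ, mul_neg_one, neg_neg]
  · rw [h, pow_succ, mul_neg_one]

/-! ### `δ ∘ δ = 0` for the full ordered Čech complex -/

/-- **The double faces cancel in pairs** (`δ ∘ δ = 0` for the full ordered Čech complex,
elementwise form): for every function `g` on the maps `Fin (n + 1) → Fin (n + 3)` with values in
an `R`-module, `Σ_{i : Fin (n+3)} Σ_{j : Fin (n+2)} (-1)^{i+j} • g (σ_i ∘ σ_j) = 0`, where
`σ = Fin.succAbove`. The involution `(i, j) ↦ (σ_i j, predAbove j i)` pairs the terms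
(Bott–Tu (1982), §8; Weibel (1994), 8.2.1; Mathlib's `AlternatingFaceMapComplex.d_squared` is
the categorical form). [cite: BottTu1982Forms, §8 (8.4)] -/
theorem sum_sum_neg_one_pow_smul_faces_eq_zero {R : Type*} [Ring R] {G : Type*} [AddCommGroup G]
    [Module R G] {n : ℕ} (g : (Fin (n + 1) → Fin (n + 3)) → G) :
    ∑ i : Fin (n + 3), ∑ j : Fin (n + 2),
      (-1 : R) ^ ((i : ℕ) + (j : ℕ)) • g (Fin.succAbove i ∘ Fin.succAbove j) = 0 := by
  rw [← Fintype.sum_prod_type']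
  refine Finset.sum_ninvolution (fun x ↦ (x.1.succAbove x.2, x.2.predAbove x.1)) ?_ ?_
    (fun _ ↦ Finset.mem_univ _) ?_
  · intro x
    have hfun : (x.1.succAbove x.2).succAbove ∘ (x.2.predAbove x.1).succAbove =
        x.1.succAbove ∘ x.2.succAbove :=
      funext fun k ↦ Fin.succAbove_succAbove_succAbove_predAbove x.1 x.2 k
    dsimp only
    rw [hfun, neg_one_pow_succAbove_add_predAbove, neg_smul, add_neg_cancel]
  · intro x _ h
    exact Fin.succAbove_ne x.1 x.2 (congrArg Prod.fst h)
  · intro x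
    exact Prod.ext (Fin.succAbove_succAbove_predAbove x.1 x.2)
      (Fin.predAbove_predAbove_succAbove x.1 x.2)

/-- The same cancellation with the signs split as `(-1)^i • (-1)^j • _`. [cite: BottTu1982Forms, §8 (8.4)] -/
theorem sum_sum_neg_one_pow_smul_smul_faces_eq_zero {R : Type*} [Ring R] {G : Type*}
    [AddCommGroup G] [Module R G] {n : ℕ} (g : (Fin (n + 1) → Fin (n + 3)) → G) :
    ∑ i : Fin (n + 3), ∑ j : Fin (n + 2),
      (-1 : R) ^ (i : ℕ) • (-1 : R) ^ (j : ℕ) • g (Fin.succAbove i ∘ Fin.succAbove j) = 0 := by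
  simp only [smul_smul, ← pow_add]
  exact sum_sum_neg_one_pow_smul_faces_eq_zero g

/-! ### Faces of an extended tuple -/

/-- The `0`-th face of the extended tuple `(a, J)` is `J`. [folklore] -/
theorem cons_comp_succAbove_zero {α : Type*} {n : ℕ} (a : α) (J : Fin (n + 1) → α) :
    (Fin.cons a J : Fin (n + 2) → α) ∘ Fin.succAbove 0 = J := by
  funext k
  simp

/-- The `(j + 1)`-st face of the extended tuple `(a, J)` is the extended `j`-th face `(a, J ∘ σ_j)`.
[folklore] -/
theorem cons_comp_succAbove_succ {α : Type*} {n : ℕ} (a : α) (J : Fin (n + 1) → α)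
    (j : Fin (n + 1)) :
    (Fin.cons a J : Fin (n + 2) → α) ∘ Fin.succAbove j.succ =
      (Fin.cons a (J ∘ Fin.succAbove j) : Fin (n + 1) → α) := by
  funext k
  refine Fin.cases ?_ (fun k ↦ ?_) k
  · simp
  · simp [Fin.succ_succAbove_succ]

/-- The value of the extended tuple `(a, J)` at `0` is `a` (restated for tuples of a fixed type).
[folklore] -/
theorem cons_apply_zero {α : Type*} {n : ℕ} (a : α) (J : Fin n → α) :
    (Fin.cons a J : Fin (n + 1) → α) 0 = a :=
  rfl

/-- The value of the extended tuple `(a, J)` at `k + 1` is `J k` (restated for tuples of a fixed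
type). [folklore] -/
theorem cons_apply_succ {α : Type*} {n : ℕ} (a : α) (J : Fin n → α) (k : Fin n) :
    (Fin.cons a J : Fin (n + 1) → α) k.succ = J k := by
  simp

/-- **An alternating sum over the faces of an extended tuple** splits off the `0`-th face:
`Σ_{l : Fin (n+3)} (-1)^l f ((a, J) ∘ σ_l) = f J - Σ_{j : Fin (n+2)} (-1)^j f (a, J ∘ σ_j)`
(the computation behind the contracting homotopy of the Čech rows, Bott–Tu (1982), Prop. 8.5).
[cite: BottTu1982Forms, Prop. 8.5] -/
theorem sum_neg_one_pow_smul_cons_faces {R : Type*} [Ring R] {G : Type*} [AddCommGroup G]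
    [Module R G] {α : Type*} {n : ℕ} (a : α) (J : Fin (n + 2) → α)
    (f : (Fin (n + 2) → α) → G) :
    ∑ l : Fin (n + 3), (-1 : R) ^ (l : ℕ) • f ((Fin.cons a J : Fin (n + 3) → α) ∘ Fin.succAbove l) =
      f J - ∑ j : Fin (n + 2), (-1 : R) ^ (j : ℕ) •
        f (Fin.cons a (J ∘ Fin.succAbove j) : Fin (n + 2) → α) := by
  rw [Fin.sum_univ_succ, Fin.val_zero, pow_zero, one_smul, cons_comp_succAbove_zero, sub_eq_add_neg,
    ← Finset.sum_neg_distrib]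
  congr 1
  refine Finset.sum_congr rfl fun j _ ↦ ?_
  rw [cons_comp_succAbove_succ, Fin.val_succ, pow_succ, mul_neg_one, neg_smul]

end CechTuple

end Literature.Algebra.Homology
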